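import Summits.CriticalPhenomena.PercolationContinuityZ3.Theorems.PercNearOneGluingNoHeavyLowerTailSahiCombShapeTwo
import Summits.CriticalPhenomena.PercolationContinuityZ3.Theorems.PercNearOneGluingNoHeavyLowerTailSahiCombUnique
import Summits.CriticalPhenomena.PercolationContinuityZ3.Theorems.PercNearOneGluingNoHeavyLowerTailSahiUniformReduction

/-!
# The FULL-DISAGREEMENT rung `Dis` of the three-copy comb sum, the mixed/free peeling identity, and
# `COMB-C3 ⟹ Dis ⟹ Kahn's Conjecture 5`

Support file of the one-cut programme (crux `NoHeavyLowerTail`, stmt-CriticalPhenomena-4575; cell `prim-bnk`, seat bnk-2 gen 12,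
memo `run/shared/lean/prim/prim-l12/FROM-prim-bnk-2-g12-MIX-RUNGS.md`; INEQ-CLAIMS rows DIS / HALF-MIX / COMB-M-E3).  Companion:
`…SahiCombHalfMix` (the HALF letter on the fully mixed background: `HalfMix ⟹ HALF(½) ⟹` Kahn).

Let `c_U(j)` (`SahiComb.combCoeff 3 (1_U) j`, `j : ι → ℕ`, `j ≤ 3`) be the three-copy comb array of a triple `U` of events of the
cube `Set ι`: the sum of the Richards–Sahi kernel over all triples of copies with profile `j` (`j_e` = number of copies open at
`e`); `E_3(μ_p; 1_U) = Σ_j c_U(j)·∏_e p_e^{j_e}(1−p_e)^{3−j_e}` (`sahiE_bernoulliWeight_eq_sum_combCoeff`).  The digits `j_e ∈ {0,3}`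
are the two SECTIONS at `e` (face lemmas `combCoeff_ind_eq_secAt_false`, `combCoeff_ind_update_top_eq_secAt_true`); the digits
`j_e ∈ {1,2}` are the cells where the three copies DISAGREE at `e` (exactly one copy is odd).
* `mfSum U R S` — the MIXED/FREE partial sum `Σ c_U(j)` over the profiles that are mixed (`∈ {1,2}`) on `R`, free on `S` and `0`
  elsewhere; `disSum U R := mfSum U R ∅` is the **full-disagreement sum** of `U` read as a triple on the coordinates `R`
  (`= 6^{|R|}·𝔼 Ψ` for three copies that pairwise disagree… i.e. with exactly one odd copy at every coordinate: the exchangeable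
  three-point coupling of the uniform cube with the most negative pairwise correlation, `ρ = −1/3`; memo §1).
* **`mfSum_insert` (the peeling identity)**: for `e ∉ R ∪ S`,
  `mfSum U R (insert e S) = mfSum U^{e←0} R S + mfSum U^{e←1} R S + mfSum U (insert e R) S`
  (split the free digit at `e` into `0 | 3 | {1,2}`; the first two are the sections by the face lemmas).
* **`Dis` (conjecture DIS, new, OPEN)**: `0 ≤ disSum U R` for every triple of increasing events determined by `R`, on every finite
  cube.  It is the SUM of the `2^{|R|}` fully-mixed comb cells, so it is implied by coefficientwise comb positivity
  (`dis_of_masterFamilyCombCoeffNonneg`: `MasterFamilyCombCoeffNonneg 3 → Dis`, i.e. COMB-C3 / `ThreePartitionPositivityTwisted` ⟹ DIS),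
  and by the peeling identity it implies `0 ≤ mfSum U R S` for all `R, S` (`mfSum_nonneg_of_dis`, induction on `S`), in particular
  `0 ≤ Σ_j c_U(j) = 2^{3r}·E_3(μ_{1/2}; 1_U)` on `Fin r` (`sahiE_half_nonneg_of_dis`): **`kahnConjecture_of_dis : Dis → KahnConjecture`**
  through `SahiUniform.kahnConjecture_iff_forall_half`.  So DIS is a rung strictly between the lane's coefficientwise law and Kahn's
  Conjecture 5: `MasterFamilyCombCoeffNonneg 3 ⟹ Dis ⟹ KahnConjecture`.
CENSUS of DIS (memo §3; exact integer engines `combexh.c` / best response `combbr.c`): `m ≤ 4` exhaustive (776 216 unordered triples),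
exact-best-response searches `m = 5, 6, 7` (39 000 / 46 500 / 20 800 multi-slot descents): minimum `0` (attained), never negative.
Everything below is proved; axioms standard; `Dis`, `MasterFamilyCombCoeffNonneg 3` and `KahnConjecture` remain OPEN (obligations,
never facts). [this work]
-/

noncomputable section

open scoped Classical

namespace Summit.CriticalPhenomena.PercolationContinuityZ3.Theorems

open Finset Function
open Literature.Combinatorics.Sahi2008
open Literature.Probability.Percolation (DeterminedBy determinedBy_iff)
open Literature.Probability.Percolation.DecisionTree (ind ind_of_mem ind_of_not_mem ind_nonneg)
open SahiComb
open SahiTwoLevelHalf (half)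

namespace SahiCombMix

variable {ι : Type} [Fintype ι]

/-! ### Mixed / free profile sums -/

/-- The profile `j` is MIXED (`j_e ∈ {1,2}`) on `R` and vanishes off `R ∪ S` (free on `S`). [this work] -/
def MixFree (R S : Finset ι) (j : ι → ℕ) : Prop :=
  (∀ e ∈ R, j e = 1 ∨ j e = 2) ∧ ∀ e, e ∉ R → e ∉ S → j e = 0

/-- **The mixed/free partial comb sum** `Σ {c_U(j) : j ≤ 3, j mixed on R, free on S, 0 elsewhere}`. [this work] -/
def mfSum (U : Fin 3 → Set (Set ι)) (R S : Finset ι) : ℝ :=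
  ∑ j ∈ box (fun _ : ι => 3), if MixFree R S j then combCoeff 3 (fun i => ind (U i)) j else 0

/-- **The full-disagreement sum** of `U` read as a triple on the coordinates `R`: the sum of the `2^{|R|}` fully-mixed comb cells
(`j_e ∈ {1,2}` on `R`, `0` elsewhere). [this work] -/
def disSum (U : Fin 3 → Set (Set ι)) (R : Finset ι) : ℝ := mfSum U R ∅

/-- **Conjecture DIS** (bnk-2 gen 12; INEQ-CLAIMS row DIS): on every finite cube, every triple of increasing events determined by a
set `R` of coordinates has nonnegative full-disagreement sum over `R` — equivalently, Sahi's three-copy kernel has nonnegative mean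
when the three copies are `X, X △ S₃ᶜ, X △ S₂ᶜ` for a uniform point `X` and a uniform ordered 3-partition `(S₁,S₂,S₃)` of `R`.
Implied by `MasterFamilyCombCoeffNonneg 3` (`dis_of_masterFamilyCombCoeffNonneg`), implies Kahn's Conjecture 5
(`kahnConjecture_of_dis`).  OPEN; an obligation of our theories, never a fact. [this work] [status: open] -/
@[conjecture] def Dis : Prop :=
  ∀ (ι : Type) [Fintype ι] (U : Fin 3 → Set (Set ι)), (∀ i, IsUpperSet (U i)) →
    ∀ R : Finset ι, (∀ i, DeterminedBy (U i) (↑R : Set ι)) → 0 ≤ disSum U R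

/-! ### Bookkeeping on profiles -/

omit [Fintype ι] in
/-- `MixFree R (insert e S) (j[e ↦ t]) ↔ MixFree R S j` when `e ∉ R`, `e ∉ S`, `j e = 0`. [this work] -/
theorem mixFree_insert_update_iff {R S : Finset ι} {e : ι} (heR : e ∉ R) (heS : e ∉ S) {j : ι → ℕ} (hj : j e = 0)
    (t : ℕ) : MixFree R (insert e S) (update j e t) ↔ MixFree R S j := by
  constructor
  · rintro ⟨h1, h2⟩
    refine ⟨fun x hx => ?_, fun x hxR hxS => ?_⟩
    · have hxe : x ≠ e := fun h => heR (h ▸ hx)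
      have := h1 x hx
      rwa [update_of_ne hxe] at this
    · by_cases hxe : x = e
      · subst hxe; exact hj
      · have := h2 x hxR (fun h => (Finset.mem_insert.1 h).elim hxe hxS)
        rwa [update_of_ne hxe] at this
  · rintro ⟨h1, h2⟩
    refine ⟨fun x hx => ?_, fun x hxR hxS => ?_⟩
    · have hxe : x ≠ e := fun h => heR (h ▸ hx)
      rw [update_of_ne hxe]; exact h1 x hx
    · have hxe : x ≠ e := fun h => hxS (h ▸ Finset.mem_insert_self e S)
      rw [update_of_ne hxe]
      exact h2 x hxR fun h => hxS (Finset.mem_insert_of_mem h)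

omit [Fintype ι] in
/-- `MixFree (insert e R) S (j[e ↦ t]) ↔ (t = 1 ∨ t = 2) ∧ MixFree R S j` when `e ∉ R`, `e ∉ S`, `j e = 0`. [this work] -/
theorem mixFree_insert_left_update_iff {R S : Finset ι} {e : ι} (heR : e ∉ R) (heS : e ∉ S) {j : ι → ℕ} (hj : j e = 0)
    (t : ℕ) : MixFree (insert e R) S (update j e t) ↔ (t = 1 ∨ t = 2) ∧ MixFree R S j := by
  constructor
  · rintro ⟨h1, h2⟩
    have ht : t = 1 ∨ t = 2 := by
      have := h1 e (Finset.mem_insert_self e R)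
      rwa [update_self] at this
    refine ⟨ht, fun x hx => ?_, fun x hxR hxS => ?_⟩
    · have hxe : x ≠ e := fun h => heR (h ▸ hx)
      have := h1 x (Finset.mem_insert_of_mem hx)
      rwa [update_of_ne hxe] at this
    · by_cases hxe : x = e
      · subst hxe; exact hj
      · have := h2 x (fun h => (Finset.mem_insert.1 h).elim hxe hxR) hxS
        rwa [update_of_ne hxe] at this
  · rintro ⟨ht, h1, h2⟩
    refine ⟨fun x hx => ?_, fun x hxR hxS => ?_⟩
    · rcases Finset.mem_insert.1 hx with hxe | hx
      · subst hxe; rw [update_self]; exact ht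
      · have hxe : x ≠ e := fun h => heR (h ▸ hx)
        rw [update_of_ne hxe]; exact h1 x hx
    · have hxe : x ≠ e := fun h => hxR (h ▸ Finset.mem_insert_self e R)
      rw [update_of_ne hxe]
      exact h2 x (fun h => hxR (Finset.mem_insert_of_mem h)) hxS

omit [Fintype ι] in
/-- If `e ∉ R ∪ S` then `MixFree R S (j[e ↦ t]) ↔ t = 0 ∧ MixFree R S j` for `j e = 0`. [this work] -/
theorem mixFree_update_iff {R S : Finset ι} {e : ι} (heR : e ∉ R) (heS : e ∉ S) {j : ι → ℕ} (hj : j e = 0) (t : ℕ) :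
    MixFree R S (update j e t) ↔ t = 0 ∧ MixFree R S j := by
  have hu : update j e 0 = j := update_eq_self_iff.2 hj.symm
  constructor
  · rintro ⟨h1, h2⟩
    have ht : t = 0 := by
      have := h2 e heR heS
      rwa [update_self] at this
    subst ht
    rw [hu] at h1 h2
    exact ⟨rfl, h1, h2⟩
  · rintro ⟨ht, h⟩
    subst ht
    rwa [hu]

/-- A profile in the box `3[e ↦ 0]` vanishes at `e`. [folklore] -/
theorem apply_eq_zero_of_mem_box_update {e : ι} {j : ι → ℕ} (hj : j ∈ box (update (fun _ : ι => (3 : ℕ)) e 0)) :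
    j e = 0 :=
  Nat.le_zero.1 (by simpa using mem_box.1 hj e)

/-- **`mfSum` only sees the profiles with `j_e = 0` when `e ∉ R ∪ S`**: the sum may be taken over the box `3[e ↦ 0]`. [this work] -/
theorem mfSum_eq_sum_box_update (U : Fin 3 → Set (Set ι)) {R S : Finset ι} {e : ι} (heR : e ∉ R) (heS : e ∉ S) :
    mfSum U R S = ∑ j ∈ box (update (fun _ : ι => (3 : ℕ)) e 0),
      if MixFree R S j then combCoeff 3 (fun i => ind (U i)) j else 0 := by
  unfold mfSum
  rw [sum_box_eq_sum_fiber_update (fun _ : ι => (3 : ℕ)) e, Finset.sum_range_succ', Finset.sum_eq_zero, zero_add]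
  · refine sum_congr rfl fun j hj => ?_
    rw [update_eq_self_iff.2 (apply_eq_zero_of_mem_box_update hj).symm]
  · intro t _
    refine sum_eq_zero fun j hj => ?_
    have hj0 := apply_eq_zero_of_mem_box_update hj
    rw [if_neg]
    intro h
    exact Nat.succ_ne_zero t ((mixFree_update_iff heR heS hj0 (t + 1)).1 h).1

/-! ### The peeling identity -/

/-- **PEELING A FREE COORDINATE**: for `e ∉ R ∪ S`,
`mfSum U R (insert e S) = mfSum U^{e←0} R S + mfSum U^{e←1} R S + mfSum U (insert e R) S`
(the free digit at `e` is `0` — the `false`-section —, `3` — the `true`-section —, or mixed). [this work] -/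
theorem mfSum_insert (U : Fin 3 → Set (Set ι)) {R S : Finset ι} {e : ι} (heR : e ∉ R) (heS : e ∉ S) :
    mfSum U R (insert e S) = mfSum (fun i => secAt e false (U i)) R S + mfSum (fun i => secAt e true (U i)) R S
      + mfSum U (insert e R) S := by
  -- abbreviations: the box with `j_e = 0` and the digit-`t` partial sums
  set B := box (update (fun _ : ι => (3 : ℕ)) e 0) with hB
  have hB0 : ∀ j ∈ B, j e = 0 := fun j hj => apply_eq_zero_of_mem_box_update hj
  -- digit 0 = the `false`-section
  have hd0 : ∑ j ∈ B, (if MixFree R (insert e S) (update j e 0) then combCoeff 3 (fun i => ind (U i)) (update j e 0) else 0)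
      = ∑ j ∈ B, (if MixFree R S j then combCoeff 3 (fun i => ind (secAt e false (U i))) j else 0) := by
    refine sum_congr rfl fun j hj => ?_
    have hj0 := hB0 j hj
    rw [mixFree_insert_update_iff heR heS hj0, update_eq_self_iff.2 hj0.symm]
    split_ifs
    · exact combCoeff_ind_eq_secAt_false U e hj0
    · rfl
  -- digit 3 = the `true`-section
  have hd3 : ∑ j ∈ B, (if MixFree R (insert e S) (update j e 3) then combCoeff 3 (fun i => ind (U i)) (update j e 3) else 0)
      = ∑ j ∈ B, (if MixFree R S j then combCoeff 3 (fun i => ind (secAt e true (U i))) j else 0) := by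
    refine sum_congr rfl fun j hj => ?_
    have hj0 := hB0 j hj
    rw [mixFree_insert_update_iff heR heS hj0]
    split_ifs
    · rw [combCoeff_ind_update_top_eq_secAt_true U e j, update_eq_self_iff.2 hj0.symm]
    · rfl
  -- digits 1, 2 = the mixed branch
  have hd12 : ∀ t : ℕ, (t = 1 ∨ t = 2) →
      ∑ j ∈ B, (if MixFree R (insert e S) (update j e t) then combCoeff 3 (fun i => ind (U i)) (update j e t) else 0)
      = ∑ j ∈ B, (if MixFree (insert e R) S (update j e t) then combCoeff 3 (fun i => ind (U i)) (update j e t) else 0) := by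
    intro t ht
    refine sum_congr rfl fun j hj => ?_
    have hj0 := hB0 j hj
    have hiff : MixFree R (insert e S) (update j e t) ↔ MixFree (insert e R) S (update j e t) := by
      rw [mixFree_insert_update_iff heR heS hj0, mixFree_insert_left_update_iff heR heS hj0]
      exact ⟨fun h => ⟨ht, h⟩, fun h => h.2⟩
    simp only [hiff]
  have hz : ∀ t : ℕ, ¬(t = 1 ∨ t = 2) →
      ∑ j ∈ B, (if MixFree (insert e R) S (update j e t) then combCoeff 3 (fun i => ind (U i)) (update j e t) else 0) = 0 := by
    intro t ht
    refine sum_eq_zero fun j hj => ?_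
    rw [if_neg]
    intro h
    exact ht ((mixFree_insert_left_update_iff heR heS (hB0 j hj) t).1 h).1
  -- expand both free sums over the fibred box
  have hL : mfSum U R (insert e S) =
      ∑ j ∈ B, (if MixFree R S j then combCoeff 3 (fun i => ind (secAt e false (U i))) j else 0)
      + ∑ j ∈ B, (if MixFree (insert e R) S (update j e 1) then combCoeff 3 (fun i => ind (U i)) (update j e 1) else 0)
      + ∑ j ∈ B, (if MixFree (insert e R) S (update j e 2) then combCoeff 3 (fun i => ind (U i)) (update j e 2) else 0)
      + ∑ j ∈ B, (if MixFree R S j then combCoeff 3 (fun i => ind (secAt e true (U i))) j else 0) := by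
    unfold mfSum
    rw [sum_box_eq_sum_fiber_update (fun _ : ι => (3 : ℕ)) e]
    simp only [Finset.sum_range_succ, Finset.sum_range_zero, zero_add]
    rw [← hB, hd0, hd3, hd12 1 (Or.inl rfl), hd12 2 (Or.inr rfl)]
  have hM : mfSum U (insert e R) S =
      ∑ j ∈ B, (if MixFree (insert e R) S (update j e 1) then combCoeff 3 (fun i => ind (U i)) (update j e 1) else 0)
      + ∑ j ∈ B, (if MixFree (insert e R) S (update j e 2) then combCoeff 3 (fun i => ind (U i)) (update j e 2) else 0) := by
    unfold mfSum
    rw [sum_box_eq_sum_fiber_update (fun _ : ι => (3 : ℕ)) e]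
    simp only [Finset.sum_range_succ, Finset.sum_range_zero, zero_add]
    rw [← hB, hz 0 (by omega), hz 3 (by omega), zero_add, add_zero]
  rw [hL, hM, mfSum_eq_sum_box_update _ heR heS, mfSum_eq_sum_box_update _ heR heS, ← hB]
  ring

/-! ### `Dis` propagates to every mixed/free sum -/

omit [Fintype ι] in
/-- Erasing a fresh coordinate: `(R ∪ insert e S).erase e = R ∪ S` for `e ∉ R`, `e ∉ S`. [folklore] -/
theorem erase_union_insert {R S : Finset ι} {e : ι} (heR : e ∉ R) (heS : e ∉ S) :
    (R ∪ insert e S).erase e = R ∪ S := by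
  ext x
  simp only [Finset.mem_erase, Finset.mem_union, Finset.mem_insert]
  constructor
  · rintro ⟨hxe, hx | hx | hx⟩
    · exact Or.inl hx
    · exact absurd hx hxe
    · exact Or.inr hx
  · rintro (hx | hx)
    · exact ⟨fun h => heR (h ▸ hx), Or.inl hx⟩
    · exact ⟨fun h => heS (h ▸ hx), Or.inr (Or.inr hx)⟩

/-- **`Dis ⟹ 0 ≤ mfSum U R S`** for every triple of increasing events determined by `R ∪ S` (`R`, `S` disjoint): induction on `S`
by the peeling identity — the two sections are determined by `R ∪ S`, the mixed branch moves `e` from `S` to `R`. [this work] -/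
theorem mfSum_nonneg_of_dis (hD : Dis) (S : Finset ι) :
    ∀ (R : Finset ι), Disjoint R S → ∀ (U : Fin 3 → Set (Set ι)), (∀ i, IsUpperSet (U i)) →
      (∀ i, DeterminedBy (U i) (↑(R ∪ S) : Set ι)) → 0 ≤ mfSum U R S := by
  induction S using Finset.induction_on with
  | empty =>
    intro R _ U hU hUd
    have h := hD ι U hU R (fun i => by simpa using hUd i)
    exact h
  | insert e S heS ih =>
    intro R hRS U hU hUd
    have heR : e ∉ R := fun h => Finset.disjoint_left.1 hRS h (Finset.mem_insert_self e S)
    have hRS' : Disjoint R S := Finset.disjoint_of_subset_right (Finset.subset_insert e S) hRS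
    rw [mfSum_insert U heR heS]
    have hsec : ∀ (b : Bool) (i : Fin 3), DeterminedBy (secAt e b (U i)) (↑(R ∪ S) : Set ι) := by
      intro b i
      have h := determinedBy_secAt e b (hUd i)
      rwa [erase_union_insert heR heS] at h
    refine add_nonneg (add_nonneg ?_ ?_) ?_
    · exact ih R hRS' _ (fun i => isUpperSet_secAt e false (hU i)) (hsec false)
    · exact ih R hRS' _ (fun i => isUpperSet_secAt e true (hU i)) (hsec true)
    · refine ih (insert e R) ?_ U hU (fun i => ?_)
      · rw [Finset.disjoint_insert_left]; exact ⟨heS, hRS'⟩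
      · have : insert e R ∪ S = R ∪ insert e S := by
          ext x; simp only [Finset.mem_union, Finset.mem_insert]; tauto
        rw [this]; exact hUd i

/-- The total comb sum is the mixed/free sum with everything free. [this work] -/
theorem sum_combCoeff_eq_mfSum (U : Fin 3 → Set (Set ι)) :
    ∑ j ∈ box (fun _ : ι => 3), combCoeff 3 (fun i => ind (U i)) j = mfSum U ∅ Finset.univ := by
  unfold mfSum
  refine sum_congr rfl fun j _ => ?_
  rw [if_pos]
  exact ⟨fun e he => absurd he (Finset.notMem_empty e), fun e _ he => absurd (Finset.mem_univ e) he⟩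

/-- **`Dis ⟹` the total three-copy comb sum of every triple of increasing events is `≥ 0`.** [this work] -/
theorem sum_combCoeff_nonneg_of_dis (hD : Dis) (U : Fin 3 → Set (Set ι)) (hU : ∀ i, IsUpperSet (U i)) :
    0 ≤ ∑ j ∈ box (fun _ : ι => 3), combCoeff 3 (fun i => ind (U i)) j := by
  rw [sum_combCoeff_eq_mfSum]
  refine mfSum_nonneg_of_dis hD Finset.univ ∅ (Finset.disjoint_empty_left _) U hU fun i => ?_
  rw [Finset.empty_union, Finset.coe_univ]
  exact (determinedBy_iff _ _).2 fun ω ω' h => by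
    have : ω = ω' := by simpa using h
    rw [this]

/-! ### At `q ≡ 1/2` the Sahi functional is the total comb sum -/

/-- At the uniform parameter every degree-`3` basis function of a profile in the box equals `(1/2)^{3|ι|}`. [folklore] -/
theorem bern_half_eq {j : ι → ℕ} (hj : j ∈ box (fun _ : ι => 3)) :
    bern (fun _ : ι => 3) j (fun _ : ι => half) = ((1 : ℝ) / 2) ^ (3 * Fintype.card ι) := by
  unfold bern
  have hq : ((half : unitInterval) : ℝ) = 1 / 2 := rfl
  have h : ∀ e, ((half : unitInterval) : ℝ) ^ (j e) * (1 - ((half : unitInterval) : ℝ)) ^ (3 - j e)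
      = ((1 : ℝ) / 2) ^ 3 := by
    intro e
    have hje : j e ≤ 3 := mem_box.1 hj e
    rw [hq, show (1 : ℝ) - 1 / 2 = 1 / 2 by norm_num, ← pow_add, Nat.add_sub_cancel' hje]
  simp only [h, prod_const, card_univ, ← pow_mul, mul_comm]

/-- **`E_3(μ_{1/2}; 1_U) = 2^{−3|ι|}·Σ_j c_U(j)`.** [this work] -/
theorem sahiE_half_eq_sum_combCoeff (U : Fin 3 → Set (Set ι)) :
    sahiE (bernoulliWeight fun _ : ι => half) 3 (fun i => ind (U i)) =
      ((1 : ℝ) / 2) ^ (3 * Fintype.card ι) * ∑ j ∈ box (fun _ : ι => 3), combCoeff 3 (fun i => ind (U i)) j := by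
  rw [sahiE_bernoulliWeight_eq_sum_combCoeff, mul_sum]
  refine sum_congr rfl fun j hj => ?_
  rw [bern_half_eq hj, mul_comm]

/-- **`Dis ⟹` Sahi's `C_3` at the uniform measure on every finite cube.** [this work] -/
theorem sahiE_half_nonneg_of_dis (hD : Dis) (U : Fin 3 → Set (Set ι)) (hU : ∀ i, IsUpperSet (U i)) :
    0 ≤ sahiE (bernoulliWeight fun _ : ι => half) 3 (fun i => ind (U i)) := by
  rw [sahiE_half_eq_sum_combCoeff]
  exact mul_nonneg (pow_nonneg (by norm_num) _) (sum_combCoeff_nonneg_of_dis hD U hU)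

end SahiCombMix

open SahiCombMix

/-- **COMB-C3 ⟹ DIS**: coefficientwise nonnegativity of the three-copy comb array (`MasterFamilyCombCoeffNonneg 3`) gives the
full-disagreement rung (each fully-mixed cell is `≥ 0`). [this work] -/
theorem dis_of_masterFamilyCombCoeffNonneg (h : MasterFamilyCombCoeffNonneg 3) : Dis := by
  intro ι _ U hU R _
  unfold disSum mfSum
  exact sum_nonneg fun j _ => by
    split_ifs
    · exact h ι U hU j
    · exact le_rfl

/-- **DIS ⟹ KAHN'S CONJECTURE 5**: if every triple of increasing events on every finite cube has nonnegative full-disagreement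
sum, then Kahn's Conjecture 5 (`⟺ MasterFamilyNonneg 3 ⟺` Sahi's `C_3` on product measures) holds — via `C_3` at `q ≡ 1/2` on every
`Fin r` (`SahiUniform.kahnConjecture_iff_forall_half`). [this work] -/
theorem kahnConjecture_of_dis (hD : Dis) : KahnConjecture :=
  SahiUniform.kahnConjecture_iff_forall_half.2 fun _ U hU => sahiE_half_nonneg_of_dis hD U hU

/-- **DIS ⟹ the master family at `k = 3`** (every product measure on every finite cube). [this work] -/
theorem masterFamilyNonneg_three_of_dis (hD : Dis) : MasterFamilyNonneg 3 :=
  masterFamilyNonneg_three_iff_kahnConjecture.2 (kahnConjecture_of_dis hD)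

end Summit.CriticalPhenomena.PercolationContinuityZ3.Theorems
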